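import Summits.Ventures.CertifiedManyBodySolver.Rows.DopedTLCorr

/-!
# Thermodynamic-limit correlator rows away from half filling — INSTANTIATION SCHEMAS
# (a window certificate identity PROVES the row predicate of `Rows/DopedTLCorr.lean`)

HONEST FRAMING: first certified bounds; not a superconductivity verdict; every number certified or
labelled float.

Companion of `Rows/DopedTLCorr.lean` (p248178; lead D-19 r92 (c)). The binder lists of the row predicates
`ChainFillingCorrLowerRow / OrbitLowerRow` (doped chain, filling `p/q`) and
`SquareTTPrimeCorrLowerRow / OrbitLowerRow` (`t–t'` square lattice, density `n`) are the trailing binders of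
the tree soundness theorems
`InfVolFermionState.IsTorusLimitOf.re_expect_ge_of_chain_window_certificate_ineq_filling`,
`…re_sum_expect_aff_ge_of_chain_window_certificate_ineq` (`HubbardAffineOrbitCorrelatorCertificate`),
`…re_expect_ge_of_window_certificate_TT'_ineq`, `…re_sum_expect_d4_ge_of_window_certificate_TT'_ineq`
(`HubbardNNNHoppingTorusLimitCorrelator`). The four theorems below make that literal: given the certificate
DATA of the soundness theorem (Gram matrix, commutator / symmetry / charged / anti-Hermitian / residual
words, density and energy multipliers, the window identity `hcert`) with the energy cap written at the
rational slot `u`, and a rational slot `r` below the certificate value `c − Σ‖aₖ‖ + (Σμ)(filling/2 − ν)`,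
the ROW PREDICATE holds for every state of its class. A kernel-checked certificate instance is therefore
ONE term `…of_window_certificate … hcert hr`; the `@[conjecture]` claim nodes of `Certificates/` assert the
same rows for certificates checked by the cell's exact-arithmetic readers instead. Nothing is asserted
here; no new hypotheses on the state classes; no `sorry`.
-/

noncomputable section

namespace Summit.Ventures.CertifiedManyBodySolver

open Literature.MathematicalPhysics.QuantumLattice
open Matrix HubbardWave0 Literature.Probability.LatticeModels ThermodynamicLimit Filter Topology
open Literature.MathematicalPhysics.QuantumManyBody.StateRelaxation
open scoped ComplexOrder BigOperators

section Schemas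

/-- **Chain, filling `p/q`, translation-only certificate ⇒ `ChainFillingCorrLowerRow`.** The data are those
of `InfVolFermionState.IsTorusLimitOf.re_expect_ge_of_chain_window_certificate_ineq_filling` at `t = 1`
with the energy cap at the slot `u`; `hr` places the slot `r` below the certificate value. -/
theorem ChainFillingCorrLowerRow.of_window_certificate
    {U : ℝ} (hU : 0 ≤ U) {p q : ℕ} (hq : 1 ≤ q) (hp : p ≤ 2 * q) {κ : ℝ} (hκ : 0 ≤ κ) {u r : ℚ}
    {Λ Λ' : Finset (Site 1)} (hΛ : Λ ⊆ Λ')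
    (hclosed : ∀ x ∈ Λ, ∀ i : Fin 1, x + unitVec i ∈ Λ' ∧ x - unitVec i ∈ Λ')
    (h0 : thicken ({0} : Finset (Site 1)) 1 ⊆ Λ') (hz : (0 : Site 1) ∈ Λ')
    (Xw : FermionOp Λ') (μ : Fin 2 → ℝ) (ν : ℝ)
    {m : Type*} [Fintype m] [DecidableEq m] {Λm : Matrix m m ℂ} (hΛm : Λm.PosSemidef)
    (O : m → FermionOp Λ')
    {κ' : Type*} (s : Finset κ') (B : κ' → FermionOp Λ)
    {ι : Type*} (tt : Finset ι) (ε : ι → ℤˣ) (hε1 : ∀ l ∈ tt, ε l = 1) (vv : ι → Site 1)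
    (hsh : ∀ l, affShiftSet (ε l) (vv l) Λ ⊆ Λ') (Y : ι → FermionOp Λ)
    {ρ : Type*} (uu : Finset ρ) (b : ρ → ℂ) (cw : ρ → List (Orb (PolySite Λ') × Bool))
    (hcw : ∀ j ∈ uu, ladderCharge (cw j) ≠ 0 ∨ ladderSpinCharge (cw j) ≠ 0)
    {δ : Type*} (ah : Finset δ) (dc : δ → ℝ) (V : δ → FermionOp Λ')
    {κ'' : Type*} (w : Finset κ'') (a : κ'' → ℂ) (word : κ'' → List (Orb (PolySite Λ') × Bool)) {c : ℝ}
    (hcert : Xw - (c : ℂ) • (1 : FermionOp Λ') -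
        ∑ σ : Fin 2, ((μ σ : ℝ) : ℂ) • (nAt 0 hz σ - ((ν : ℝ) : ℂ) • (1 : FermionOp Λ')) -
        ((κ : ℝ) : ℂ) • ((((u : ℚ) : ℝ) : ℂ) • (1 : FermionOp Λ') -
          fermionEmbed (PolySite.incl h0) ((hubbardFermionInteraction 1 1 U).meanEnergyObs 1)) =
      gramForm Λm O +
        (∑ k ∈ s, ((hubbardFermionInteraction 1 1 U).localHamiltonian Λ' * fermionEmbed (PolySite.incl hΛ) (B k) -
            fermionEmbed (PolySite.incl hΛ) (B k) * (hubbardFermionInteraction 1 1 U).localHamiltonian Λ') +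
          ∑ l ∈ tt, (fermionEmbed (PolySite.incl (hsh l)) (fermionEmbed (PolySite.affEmb (ε l) (vv l) Λ) (Y l)) -
            fermionEmbed (PolySite.incl hΛ) (Y l)) +
          ∑ j ∈ uu, b j • ladderWord (cw j)) +
        (∑ m' ∈ ah, ((dc m' : ℝ) : ℂ) • ((V m')ᴴ - V m') + ∑ k ∈ w, a k • ladderWord (word k)))
    (hr : ((r : ℚ) : ℝ) ≤ c - ∑ k ∈ w, ‖a k‖ + (∑ σ : Fin 2, μ σ) * ((p : ℝ) / (2 * q) - ν)) :
    ChainFillingCorrLowerRow U p q u r Λ' Xw :=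
  fun _ω _mseq _nh _ψ hm hnh hψ hψ1 hω hu =>
    hr.trans (hω.re_expect_ge_of_chain_window_certificate_ineq_filling 1 hU hq hp hκ hu hΛ hclosed h0 hz
      Xw μ ν hΛm O s B tt ε hε1 vv hsh Y uu b cw hcw ah dc V w a word hcert hm hnh hψ hψ1)

/-- **Chain, filling `p/q`, reflection-reduced certificate (labels `εₗ ∈ S ⊆ ℤˣ`) ⇒
`ChainFillingCorrOrbitLowerRow … S`.** The data are those of
`InfVolFermionState.IsTorusLimitOf.re_sum_expect_aff_ge_of_chain_window_certificate_ineq` at `t = 1`. -/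
theorem ChainFillingCorrOrbitLowerRow.of_window_certificate
    {U : ℝ} (hU : 0 ≤ U) {p q : ℕ} (hq : 1 ≤ q) (hp : p ≤ 2 * q) {κ : ℝ} (hκ : 0 ≤ κ) {u r : ℚ}
    {Λ Λ' : Finset (Site 1)} (hΛ : Λ ⊆ Λ')
    (hclosed : ∀ x ∈ Λ, ∀ i : Fin 1, x + unitVec i ∈ Λ' ∧ x - unitVec i ∈ Λ')
    (h0 : thicken ({0} : Finset (Site 1)) 1 ⊆ Λ') (hz : (0 : Site 1) ∈ Λ')
    {S : Finset ℤˣ} (h1 : (1 : ℤˣ) ∈ S) (hmul : ∀ a ∈ S, ∀ b ∈ S, a * b ∈ S)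
    (Xw : FermionOp Λ') (μ : Fin 2 → ℝ) (ν : ℝ)
    {m : Type*} [Fintype m] [DecidableEq m] {Λm : Matrix m m ℂ} (hΛm : Λm.PosSemidef)
    (O : m → FermionOp Λ')
    {κ' : Type*} (s : Finset κ') (B : κ' → FermionOp Λ)
    {ι : Type*} (tt : Finset ι) (ε : ι → ℤˣ) (hεS : ∀ l ∈ tt, ε l ∈ S) (vv : ι → Site 1)
    (hsh : ∀ l, affShiftSet (ε l) (vv l) Λ ⊆ Λ') (Y : ι → FermionOp Λ)
    {ρ : Type*} (uu : Finset ρ) (b : ρ → ℂ) (cw : ρ → List (Orb (PolySite Λ') × Bool))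
    (hcw : ∀ j ∈ uu, ladderCharge (cw j) ≠ 0 ∨ ladderSpinCharge (cw j) ≠ 0)
    {δ : Type*} (ah : Finset δ) (dc : δ → ℝ) (V : δ → FermionOp Λ')
    {κ'' : Type*} (w : Finset κ'') (a : κ'' → ℂ) (word : κ'' → List (Orb (PolySite Λ') × Bool)) {c : ℝ}
    (hcert : Xw - (c : ℂ) • (1 : FermionOp Λ') -
        ∑ σ : Fin 2, ((μ σ : ℝ) : ℂ) • (nAt 0 hz σ - ((ν : ℝ) : ℂ) • (1 : FermionOp Λ')) -
        ((κ : ℝ) : ℂ) • ((((u : ℚ) : ℝ) : ℂ) • (1 : FermionOp Λ') -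
          fermionEmbed (PolySite.incl h0) ((hubbardFermionInteraction 1 1 U).meanEnergyObs 1)) =
      gramForm Λm O +
        (∑ k ∈ s, ((hubbardFermionInteraction 1 1 U).localHamiltonian Λ' * fermionEmbed (PolySite.incl hΛ) (B k) -
            fermionEmbed (PolySite.incl hΛ) (B k) * (hubbardFermionInteraction 1 1 U).localHamiltonian Λ') +
          ∑ l ∈ tt, (fermionEmbed (PolySite.incl (hsh l)) (fermionEmbed (PolySite.affEmb (ε l) (vv l) Λ) (Y l)) -
            fermionEmbed (PolySite.incl hΛ) (Y l)) +
          ∑ j ∈ uu, b j • ladderWord (cw j)) +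
        (∑ m' ∈ ah, ((dc m' : ℝ) : ℂ) • ((V m')ᴴ - V m') + ∑ k ∈ w, a k • ladderWord (word k)))
    (hr : ((r : ℚ) : ℝ) ≤ c - ∑ k ∈ w, ‖a k‖ + (∑ σ : Fin 2, μ σ) * ((p : ℝ) / (2 * q) - ν)) :
    ChainFillingCorrOrbitLowerRow U p q u r S Λ' Xw :=
  fun _ω _mseq _nh _ψ hm hnh hψ hψ1 hω hu =>
    hr.trans (hω.re_sum_expect_aff_ge_of_chain_window_certificate_ineq 1 hU hq hp hκ hu hΛ hclosed h0 hz h1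
      hmul Xw μ ν hΛm O s B tt ε hεS vv hsh Y uu b cw hcw ah dc V w a word hcert hm hnh hψ hψ1)

/-- **Square lattice, `t–t'`, density `n`, translation-only certificate ⇒ `SquareTTPrimeCorrLowerRow`.** The
data are those of `InfVolFermionState.IsTorusLimitOf.re_expect_ge_of_window_certificate_TT'_ineq` at
`t = 1`, `t' = tp`, with the energy cap at the slot `u`. -/
theorem SquareTTPrimeCorrLowerRow.of_window_certificate
    (tp : ℝ) {U : ℝ} (hU : 0 ≤ U) {n : ℝ} (hn0 : 0 ≤ n) (hn2 : n < 2) {κ : ℝ} (hκ : 0 ≤ κ) {u r : ℚ}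
    {Λ Λ' : Finset (Site 2)} (hΛ : Λ ⊆ Λ') (h8 : thicken Λ 1 ⊆ Λ')
    (h0 : thicken ({0} : Finset (Site 2)) 1 ⊆ Λ') (hz : (0 : Site 2) ∈ Λ')
    (Xw : FermionOp Λ') (μ : Fin 2 → ℝ) (ν : ℝ)
    {m : Type*} [Fintype m] [DecidableEq m] {Λm : Matrix m m ℂ} (hΛm : Λm.PosSemidef)
    (O : m → FermionOp Λ')
    {κ' : Type*} (s : Finset κ') (B : κ' → FermionOp Λ)
    {ι : Type*} (tt : Finset ι) (γ : ι → DihedralGroup 4) (hγ1 : ∀ l ∈ tt, γ l = 1) (wv : ι → Site 2)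
    (hsh : ∀ l, d4ShiftSet (γ l) (wv l) Λ ⊆ Λ') (Y : ι → FermionOp Λ)
    {ρ : Type*} (uu : Finset ρ) (b : ρ → ℂ) (cw : ρ → List (Orb (PolySite Λ') × Bool))
    (hcw : ∀ j ∈ uu, ladderCharge (cw j) ≠ 0 ∨ ladderSpinCharge (cw j) ≠ 0)
    {δ : Type*} (ah : Finset δ) (dc : δ → ℝ) (V : δ → FermionOp Λ')
    {κ'' : Type*} (w : Finset κ'') (a : κ'' → ℂ) (word : κ'' → List (Orb (PolySite Λ') × Bool)) {c : ℝ}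
    (hcert : Xw - (c : ℂ) • (1 : FermionOp Λ') -
        ∑ σ : Fin 2, ((μ σ : ℝ) : ℂ) • (nAt 0 hz σ - ((ν : ℝ) : ℂ) • (1 : FermionOp Λ')) -
        ((κ : ℝ) : ℂ) • ((((u : ℚ) : ℝ) : ℂ) • (1 : FermionOp Λ') -
          fermionEmbed (PolySite.incl h0) ((hubbardTTPrimeFermionInteraction 1 tp U).meanEnergyObs 1)) =
      gramForm Λm O +
        (∑ k ∈ s, ((hubbardTTPrimeFermionInteraction 1 tp U).localHamiltonian Λ' *
              fermionEmbed (PolySite.incl hΛ) (B k) -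
            fermionEmbed (PolySite.incl hΛ) (B k) * (hubbardTTPrimeFermionInteraction 1 tp U).localHamiltonian Λ') +
          ∑ l ∈ tt, (fermionEmbed (PolySite.incl (hsh l)) (fermionEmbed (PolySite.d4Emb (γ l) (wv l) Λ) (Y l)) -
            fermionEmbed (PolySite.incl hΛ) (Y l)) +
          ∑ j ∈ uu, b j • ladderWord (cw j)) +
        (∑ m' ∈ ah, ((dc m' : ℝ) : ℂ) • ((V m')ᴴ - V m') + ∑ k ∈ w, a k • ladderWord (word k)))
    (hr : ((r : ℚ) : ℝ) ≤ c - ∑ k ∈ w, ‖a k‖ + (∑ σ : Fin 2, μ σ) * (n / 2 - ν)) :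
    SquareTTPrimeCorrLowerRow tp U n u r Λ' Xw :=
  fun _ω _Ls _ψ hLs hψ hψ1 hω hu =>
    hr.trans (hω.re_expect_ge_of_window_certificate_TT'_ineq 1 tp hU hn0 hn2 hκ hu hΛ h8 h0 hz Xw μ ν hΛm O
      s B tt γ hγ1 wv hsh Y uu b cw hcw ah dc V w a word hcert hLs hψ hψ1)

/-- **Square lattice, `t–t'`, density `n`, `D₄`-reduced certificate (labels `γₗ ∈ S ⊆ D₄`) ⇒
`SquareTTPrimeCorrOrbitLowerRow … S`.** The data are those of
`InfVolFermionState.IsTorusLimitOf.re_sum_expect_d4_ge_of_window_certificate_TT'_ineq` at `t = 1`, `t' = tp`. -/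
theorem SquareTTPrimeCorrOrbitLowerRow.of_window_certificate
    (tp : ℝ) {U : ℝ} (hU : 0 ≤ U) {n : ℝ} (hn0 : 0 ≤ n) (hn2 : n < 2) {κ : ℝ} (hκ : 0 ≤ κ) {u r : ℚ}
    {Λ Λ' : Finset (Site 2)} (hΛ : Λ ⊆ Λ') (h8 : thicken Λ 1 ⊆ Λ')
    (h0 : thicken ({0} : Finset (Site 2)) 1 ⊆ Λ') (hz : (0 : Site 2) ∈ Λ')
    {S : Finset (DihedralGroup 4)} (h1 : (1 : DihedralGroup 4) ∈ S) (hmul : ∀ a ∈ S, ∀ b ∈ S, a * b ∈ S)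
    (Xw : FermionOp Λ') (μ : Fin 2 → ℝ) (ν : ℝ)
    {m : Type*} [Fintype m] [DecidableEq m] {Λm : Matrix m m ℂ} (hΛm : Λm.PosSemidef)
    (O : m → FermionOp Λ')
    {κ' : Type*} (s : Finset κ') (B : κ' → FermionOp Λ)
    {ι : Type*} (tt : Finset ι) (γ : ι → DihedralGroup 4) (hγS : ∀ l ∈ tt, γ l ∈ S) (wv : ι → Site 2)
    (hsh : ∀ l, d4ShiftSet (γ l) (wv l) Λ ⊆ Λ') (Y : ι → FermionOp Λ)
    {ρ : Type*} (uu : Finset ρ) (b : ρ → ℂ) (cw : ρ → List (Orb (PolySite Λ') × Bool))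
    (hcw : ∀ j ∈ uu, ladderCharge (cw j) ≠ 0 ∨ ladderSpinCharge (cw j) ≠ 0)
    {δ : Type*} (ah : Finset δ) (dc : δ → ℝ) (V : δ → FermionOp Λ')
    {κ'' : Type*} (w : Finset κ'') (a : κ'' → ℂ) (word : κ'' → List (Orb (PolySite Λ') × Bool)) {c : ℝ}
    (hcert : Xw - (c : ℂ) • (1 : FermionOp Λ') -
        ∑ σ : Fin 2, ((μ σ : ℝ) : ℂ) • (nAt 0 hz σ - ((ν : ℝ) : ℂ) • (1 : FermionOp Λ')) -
        ((κ : ℝ) : ℂ) • ((((u : ℚ) : ℝ) : ℂ) • (1 : FermionOp Λ') -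
          fermionEmbed (PolySite.incl h0) ((hubbardTTPrimeFermionInteraction 1 tp U).meanEnergyObs 1)) =
      gramForm Λm O +
        (∑ k ∈ s, ((hubbardTTPrimeFermionInteraction 1 tp U).localHamiltonian Λ' *
              fermionEmbed (PolySite.incl hΛ) (B k) -
            fermionEmbed (PolySite.incl hΛ) (B k) * (hubbardTTPrimeFermionInteraction 1 tp U).localHamiltonian Λ') +
          ∑ l ∈ tt, (fermionEmbed (PolySite.incl (hsh l)) (fermionEmbed (PolySite.d4Emb (γ l) (wv l) Λ) (Y l)) -
            fermionEmbed (PolySite.incl hΛ) (Y l)) +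
          ∑ j ∈ uu, b j • ladderWord (cw j)) +
        (∑ m' ∈ ah, ((dc m' : ℝ) : ℂ) • ((V m')ᴴ - V m') + ∑ k ∈ w, a k • ladderWord (word k)))
    (hr : ((r : ℚ) : ℝ) ≤ c - ∑ k ∈ w, ‖a k‖ + (∑ σ : Fin 2, μ σ) * (n / 2 - ν)) :
    SquareTTPrimeCorrOrbitLowerRow tp U n u r S Λ' Xw :=
  fun _ω _Ls _ψ hLs hψ hψ1 hω hu =>
    hr.trans (hω.re_sum_expect_d4_ge_of_window_certificate_TT'_ineq 1 tp hU hn0 hn2 hκ hu hΛ h8 h0 hz h1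
      hmul Xw μ ν hΛm O s B tt γ hγS wv hsh Y uu b cw hcw ah dc V w a word hcert hLs hψ hψ1)

end Schemas

end Summit.Ventures.CertifiedManyBodySolver

end
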